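import Summits.BirchSwinnertonDyer.BirchSwinnertonDyer.Theses.SignedLowerHalves
import Summits.BirchSwinnertonDyer.BirchSwinnertonDyer.Theorems.SignedLowerHalvesSprungLowerDivisibilityAtThreeKeyingUnpairedZero
import Summits.BirchSwinnertonDyer.Rank1Residual.Supersingular.X8PrintDischarge
import Literature.NumberTheory.EllipticCurves.Sprung2012.SharpFlatColemanKatoContragredient
import HarnessLib

/-!
# Negative lemma for the crux `SprungLowerDivisibilityAtThree` (item stmt-BirchSwinnertonDyer-19875), CONDITIONAL on the
# two PRINTED Sprung facts in their natural keying: the typed crux is refuted by ONE X8 pair at which `L♯` or `L♭` has an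
# `ι`-UNPAIRED zero off `(3)` — a hypothesis about `p`-adic `L`-functions ONLY (no Selmer object in `H`)

Width seat `cruxlead-stmt-BirchSwinnertonDyer-19875-w3` gen 8 (prover; D-0154 KEY (146)/(147)(a) row 8; host `pub/bsd-ssimc`).
A `--negative-modulo` lemma: ONE `def … : Prop` (the hypothesis package `UnpairedZeroX8`, a pure `∃` over the crux's own
binders and ONE prime of `Λ`; nothing asserted) and theorems taking the named facts
`Sprung2012.thm716_sharpFlatCharIdeal_divisibility_contra` (Sprung 2012 Thm. 7.16 in PRINT keying — typed by
`bsd-input-x8-contra-ty`, p662311, director (266) R1′) and `Sprung2012.thm714_sharpFlatSelmerDual_finite_torsion` (Thm. 7.14)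
as displayed hypotheses (CONDITIONAL result; neither fact is proved here). It does NOT refute the item and asserts nothing
about nature. **BSD is NOT proved; K1 is neither proved nor refuted.**

## What, and why it is the end of the keying chain

LEAD g5 (p660336 `KeyedSharpPrivateZero`, p662508 `NaturalKatoSharpPrivateZero`) and this seat (p662801
`ContraKatoUnpairedZeroX8`) conditioned «¬ typed crux» on a package containing a Selmer-side object: a naturally keyed
dual `D′` of `Sel^•` carrying Kato's divisibility `pⁿ L^• ∈ char D′.X`. With the print fact now TYPED in its natural
keying (`thm716_…_contra`, whose `.of_thm714` supplies that divisibility for EVERY γ⁻¹-keyed datum, using this seat's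
dictionary p660895 for the finiteness/torsion transport) the Selmer side leaves the hypothesis entirely:

* `UnpairedZeroX8` := ∃ ONE X8 pair `(W, 3)` with ONE instance of the crux's binders (cyclotomic `(κ, γ)`, `v ∣ 3`, `g`,
  Honda system, newform `f`, `ϖ`, Sprung pair `(L♯, L♭)`), a colour `•`, and ONE prime `𝔭₀ ∌ 3` of `Λ` with
  `L^• ∈ 𝔭₀`, `ι(L^•) ∉ 𝔭₀` — an `ι`-UNPAIRED zero of the `p`-adic `L`-function `L^•` (e.g. any private sporadic zero,
  by the tree's X8 functional equation; x8 census R-228 §0: «every coprime cell with a non-unit colour»).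
* **`SprungLowerDivisibilityAtThree_false_of_UnpairedZeroX8 (h716c) (h714) : UnpairedZeroX8 → ¬ crux`** — at the
  witness, take ANY γ⁻¹-keyed `D′` (`nonempty_sharpFlatSelmerDualData_rat`, a construction), get `∃ n, 3ⁿ L^• ∈ char D′.X`
  from `h716c.of_thm714`, and apply `ChromaticKeying.not_sprungSharpFlatLowerDivisibility_of_contraKato_of_unpairedZero`
  (p662114: keying door + crossed generator shape ⟹ every zero of `L^•` off `(p)` is `ι`-paired).

So: GIVEN Sprung's two printed theorems, the typed crux 19875 is false as soon as ONE X8 curve has a colour whose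
`p`-adic `L`-function is not `ι`-self-paired at some zero off `(3)` — a statement a per-pair certificate can decide
(cf. the cell's `ι`-self-coprimality doors `…IotaSelfCoprime`). Under the repair C′ (leaf over γ⁻¹-keyed duals) nothing
of this applies: the door's `ι` disappears and `h716c` is the leaf's own upper half.

References: Sprung, JNT 132 (2012) Thm. 7.14, Thm. 7.16, Main Conj. 7.21 [Sprung2012]; Greenberg, LNM 1716 §1 p. 60
[GreenbergLNM1716]; Greenberg, Adv. Stud. Pure Math. 17 (1989) §0 [Greenberg1989].
-/

set_option autoImplicit false
-- the problem directory `BirchSwinnertonDyer/BirchSwinnertonDyer` forces the duplicated namespace segment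
set_option linter.dupNamespace false

noncomputable section

open scoped Classical NumberField MatrixGroups ModularForm

open NumberField IsDedekindDomain CongruenceSubgroup WeierstrassCurve PowerSeries
  Literature.NumberTheory.EllipticCurves Literature.NumberTheory.EllipticCurves.ModularForms
  Literature.NumberTheory.EllipticCurves.ZpExtension Literature.NumberTheory.EllipticCurves.Sprung2017
  Literature.NumberTheory.EllipticCurves.Sprung2012 Literature.NumberTheory.EllipticCurves.Rank1Residual
  Literature.NumberTheory.EllipticCurves.IwasawaAlgebra Literature.Barriers.BirchSwinnertonDyer

namespace Summit.BirchSwinnertonDyer.BirchSwinnertonDyer.Theorems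

/-- **The hypothesis `H‴` of the negative lemma: ONE X8 pair at which some colour's `p`-adic `L`-function has an
`ι`-UNPAIRED zero off `(p)`** (a pure `∃`-package over the crux's own binders and one prime of `Λ`; NO Selmer object;
nothing asserted). Binders: X8 pair `(W, p)` (so `p = 3`), cyclotomic `(κ, γ)` with `IsCyclotomicVariable p γ`, place
`v ∣ p`, local lift `g`, Honda system `(cneg, c)`, newform `f`, period ratio `ϖ`, Sprung pair `(L♯, L♭)`, colour `•`; witness:
a prime `𝔭₀` of `Λ` with `p ∉ 𝔭₀`, `L^• ∈ 𝔭₀`, `ι(L^•) ∉ 𝔭₀` (`ι = IwasawaAlgebra.invol p`, `T ↦ (1+T)⁻¹ − 1`). (Sources, prose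
only: Sprung 2012 Thm. 2.2 / Def. 6.1 for the binders; Greenberg 1989 §0 for `ι`; x8 R-228 §0 for where such zeros are
read off the census.) -/
def UnpairedZeroX8 : Prop :=
  ∃ (W : WeierstrassCurve ℚ) (_ : W.IsElliptic) (_ : W.IsGloballyMinimal) (p : ℕ) (_ : Fact p.Prime)
    (_ : ClassX8 W p) (κ : ZpExtension ℚ p) (γ : Field.absoluteGaloisGroup ℚ)
    (_ : κ.IsCyclotomic) (_ : κ.IsTopGenerator γ) (_ : IsCyclotomicVariable p γ)
    (v : HeightOneSpectrum (𝓞 ℚ)) (_ : (p : 𝓞 ℚ) ∈ v.asIdeal)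
    (g : Field.absoluteGaloisGroup (v.adicCompletion ℚ))
    (_ : κ.IsTopGenerator (resGalOfEmb (closureEmb (K := ℚ) (v.adicCompletion ℚ)) g))
    (cneg : localPoints W (v.adicCompletion ℚ)) (c : ℕ → localPoints W (v.adicCompletion ℚ))
    (_ : IsHondaSystem κ (closureEmb (K := ℚ) (v.adicCompletion ℚ)) W (W.frobeniusTrace p) g cneg c)
    (N : ℕ) (_ : NeZero N) (f : CuspForm (Gamma0 N) 2) (ϖ : ℚ) (Lsharp Lflat : IwasawaAlgebra p)
    (_ : IsNewformOf W f) (_ : (ϖ : ℝ) * W.realPeriodRat = plusPeriod f)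
    (_ : IsSprungPair f p (W.frobeniusTrace p) Lsharp Lflat) (col : Chroma)
    (𝔭₀ : PrimeSpectrum (IwasawaAlgebra p)),
    (p : IwasawaAlgebra p) ∉ 𝔭₀.asIdeal ∧ chromaticL col Lsharp Lflat ∈ 𝔭₀.asIdeal ∧
      invol p (chromaticL col Lsharp Lflat) ∉ 𝔭₀.asIdeal

/-- **NEGATIVE LEMMA, CONDITIONAL ON THE TWO PRINTED FACTS (natural keying):**
`thm716_sharpFlatCharIdeal_divisibility_contra → thm714_sharpFlatSelmerDual_finite_torsion → UnpairedZeroX8 → ¬ SprungLowerDivisibilityAtThree`.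
At the witness pair and colour: a contragredient dual `D′` of `Sel^•` exists (`nonempty_sharpFlatSelmerDualData_rat`, a
construction); `h716c.of_thm714` gives `∃ n, pⁿ L^• ∈ char D′.X` (Sprung Thm. 7.16 as printed; Thm. 7.14 supplies the
finiteness/torsion through the γ ↔ γ⁻¹ dictionary); the crux gives the typed leaf at `(W, p, •)`, and
`ChromaticKeying.not_sprungSharpFlatLowerDivisibility_of_contraKato_of_unpairedZero` derives the contradiction at the
`ι`-unpaired zero `𝔭₀`. Nothing about Sprung's Main Conjecture 7.21 is refuted; nothing is asserted about nature.
[cite: Sprung2012, Thm. 7.14 and Thm. 7.16 (p. 1504), Main Conj. 7.21 (p. 1505)] [cite: GreenbergLNM1716, §1 (p. 60)] -/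
theorem SprungLowerDivisibilityAtThree_false_of_UnpairedZeroX8
    (h716c : thm716_sharpFlatCharIdeal_divisibility_contra) (h714 : thm714_sharpFlatSelmerDual_finite_torsion) :
    UnpairedZeroX8 →
      ¬ Summit.BirchSwinnertonDyer.BirchSwinnertonDyer.Theses.SignedLowerHalves.SprungLowerDivisibilityAtThree := by
  rintro ⟨W, hE, hGM, p, hp, hX, κ, γ, hκ, hγ, hcv, v, hv, g, hg, cneg, c, hH, N, hN, f, ϖ, Lsharp, Lflat, hf, hϖ, hSP,
    col, 𝔭₀, hp𝔭₀, hL𝔭₀, hιL𝔭₀⟩ hK1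
  haveI : NeZero N := hN
  have hne : chromaticL col Lsharp Lflat ≠ 0 :=
    ChromaticBothColours.ClassX8.chromaticL_ne_zero W p hX f Lsharp Lflat hf hSP col
  -- `p = 3`: odd, good, supersingular
  have hp2 : p ≠ 2 := by rw [hX.p_eq]; decide
  have hgood : W.HasGoodReductionAtPrime p :=
    Summit.BirchSwinnertonDyer.Rank1Residual.Supersingular.ClassX8.good W p hX
  have hss : (p : ℤ) ∣ W.frobeniusTrace p :=
    Summit.BirchSwinnertonDyer.Rank1Residual.Supersingular.ClassX8.dvd_frobeniusTrace W p hX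
  -- a contragredient dual of `Sel^•` and Sprung's printed Thm. 7.16 for it
  obtain ⟨D'⟩ := nonempty_sharpFlatSelmerDualData_rat W κ γ⁻¹ v g c col
  have hKato : ∃ n : ℕ, (p : IwasawaAlgebra p) ^ n * chromaticL col Lsharp Lflat ∈ D'.charIdeal :=
    (h716c.of_thm714 h714 hp2 hgood hss hf hκ hγ hcv hv hg hH hSP hne D').1
  exact ChromaticKeying.not_sprungSharpFlatLowerDivisibility_of_contraKato_of_unpairedZero W p col κ γ hκ hγ hcv v hv
    g hg cneg c hH N hN f ϖ Lsharp Lflat hf hϖ hSP hne D' hKato 𝔭₀ hp𝔭₀ hL𝔭₀ hιL𝔭₀ (hK1 W p hX col)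

/-- **X8 PRIVATE-zero form, colour ♯** (the reading of KEYING-g5 §2, now modulo print only): given the two printed facts,
ONE X8 pair with the crux's binders and ONE prime `𝔭₀ ∌ 3, T, Φ₃(1+T)` with `L♯ ∈ 𝔭₀`, `L♭ ∉ 𝔭₀` refutes the typed crux
(private ⟹ `ι`-unpaired by the tree's X8 functional equation, inside
`ChromaticKeying.not_sprungSharpFlatLowerDivisibility_sharp_of_contraKato_of_privateZero`).
[cite: Sprung2012, Thm. 7.14 and Thm. 7.16 (p. 1504)] [cite: Sprung2017, Thm. 4.13 and Cor. 4.14] -/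
theorem SprungLowerDivisibilityAtThree_false_of_sharpPrivateZero
    (h716c : thm716_sharpFlatCharIdeal_divisibility_contra) (h714 : thm714_sharpFlatSelmerDual_finite_torsion)
    (W : WeierstrassCurve ℚ) [W.IsElliptic] [W.IsGloballyMinimal] (p : ℕ) [Fact p.Prime] (hX : ClassX8 W p)
    (κ : ZpExtension ℚ p) (γ : Field.absoluteGaloisGroup ℚ)
    (hκ : κ.IsCyclotomic) (hγ : κ.IsTopGenerator γ) (hcv : IsCyclotomicVariable p γ)
    (v : HeightOneSpectrum (𝓞 ℚ)) (hv : (p : 𝓞 ℚ) ∈ v.asIdeal)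
    (g : Field.absoluteGaloisGroup (v.adicCompletion ℚ))
    (hg : κ.IsTopGenerator (resGalOfEmb (closureEmb (K := ℚ) (v.adicCompletion ℚ)) g))
    (cneg : localPoints W (v.adicCompletion ℚ)) (c : ℕ → localPoints W (v.adicCompletion ℚ))
    (hH : IsHondaSystem κ (closureEmb (K := ℚ) (v.adicCompletion ℚ)) W (W.frobeniusTrace p) g cneg c)
    (N : ℕ) (hN : NeZero N) (f : CuspForm (Gamma0 N) 2) (ϖ : ℚ) (Lsharp Lflat : IwasawaAlgebra p)
    (hf : IsNewformOf W f) (hϖ : (ϖ : ℝ) * W.realPeriodRat = plusPeriod f)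
    (hSP : IsSprungPair f p (W.frobeniusTrace p) Lsharp Lflat)
    (𝔭₀ : PrimeSpectrum (IwasawaAlgebra p)) (hp𝔭₀ : (p : IwasawaAlgebra p) ∉ 𝔭₀.asIdeal)
    (hT : (PowerSeries.X : IwasawaAlgebra p) ∉ 𝔭₀.asIdeal)
    (hΦ : ((1 + PowerSeries.X : IwasawaAlgebra p) ^ 2 + (1 + PowerSeries.X) + 1) ∉ 𝔭₀.asIdeal)
    (hLs : Lsharp ∈ 𝔭₀.asIdeal) (hLf : Lflat ∉ 𝔭₀.asIdeal) :
    ¬ Summit.BirchSwinnertonDyer.BirchSwinnertonDyer.Theses.SignedLowerHalves.SprungLowerDivisibilityAtThree := by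
  intro hK1
  haveI : NeZero N := hN
  have hne : chromaticL Chroma.sharp Lsharp Lflat ≠ 0 :=
    ChromaticBothColours.ClassX8.chromaticL_ne_zero W p hX f Lsharp Lflat hf hSP Chroma.sharp
  have hp2 : p ≠ 2 := by rw [hX.p_eq]; decide
  have hgood : W.HasGoodReductionAtPrime p :=
    Summit.BirchSwinnertonDyer.Rank1Residual.Supersingular.ClassX8.good W p hX
  have hss : (p : ℤ) ∣ W.frobeniusTrace p :=
    Summit.BirchSwinnertonDyer.Rank1Residual.Supersingular.ClassX8.dvd_frobeniusTrace W p hX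
  obtain ⟨D'⟩ := nonempty_sharpFlatSelmerDualData_rat W κ γ⁻¹ v g c Chroma.sharp
  have hKato : ∃ n : ℕ, (p : IwasawaAlgebra p) ^ n * Lsharp ∈ D'.charIdeal := by
    have h := (h716c.of_thm714 h714 hp2 hgood hss hf hκ hγ hcv hv hg hH hSP hne D').1
    rwa [chromaticL_sharp] at h
  exact ChromaticKeying.not_sprungSharpFlatLowerDivisibility_sharp_of_contraKato_of_privateZero W p hX κ γ hκ hγ hcv
    v hv g hg cneg c hH N hN f ϖ Lsharp Lflat hf hϖ hSP D' hKato 𝔭₀ hp𝔭₀ hT hΦ hLs hLf (hK1 W p hX Chroma.sharp)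

end Summit.BirchSwinnertonDyer.BirchSwinnertonDyer.Theorems

end
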